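import Literature.NumberTheory.Weil1964.AdelicDoublingDefectCharacterTrivial
import HarnessLib

/-!
# Normalising lifts in the adelic metaplectic group by their `L²` modulus

Two elements `p, p'` of `Mp_ψ(W_𝔸)ᶜᵒⁿᵗ = adelicMpCont F (Fin n) T` over the SAME point of `Sp(W_𝔸)`
differ by a central scalar `(1, t·id)`, `t ∈ ℂˣ` (★ `adelicMpCont.exists_eq_ofScalar_of_proj_eq_one`),
and the size of that scalar is read off the `L²` moduli (★ `adelicMpCont.l2Scaling`,
★ `l2Scaling_ofScalar`): `|t|² = L(p')/L(p)`.  Consequently **the pointwise modulus `|ω(p)Φ|` of the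
Weil operator depends only on `(π(p), L(p))`**:
* `exists_eq_mul_ofScalar_of_proj_eq` — `π(p) = π(p') ⇒ p' = p · (1, t·id)`;
* `l2Scaling_eq_mul_of_eq_mul_ofScalar`, `enorm_sq_eq_div_of_eq_mul_ofScalar`,
  `norm_eq_sqrt_div_of_eq_mul_ofScalar` — `L(p') = L(p)·‖t‖²`, `‖t‖ = √(L(p')/L(p))`;
* `coe_omega_apply_of_eq_mul_ofScalar`, `norm_omega_apply_of_proj_eq` —
  `‖(ω(p')Φ)(x)‖ = √(L(p')/L(p)) · ‖(ω(p)Φ)(x)‖`, and `norm_omega_apply_eq_of_proj_eq_of_l2Scaling_eq`;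
* `eq_inv_mul_mul_liftThrough`, `proj_liftThrough`, `l2Scaling_liftThrough`,
  `apply_omega_eq_of_comp_omega_eq` — the bookkeeping of the lift `k̃ := p_{b'}⁻¹ · r · p_b` of a
  reduction identity `b = γ⁻¹ b' k`: `p_b = r⁻¹ · p_{b'} · k̃`, `π(k̃) = π(p_{b'})⁻¹ π(r) π(p_b)`,
  `L(k̃) = L(p_b) · L(r) / L(p_{b'})`, and for a functional `E` with `E ∘ ω(r⁻¹) = E`:
  `E(ω(p_b)Ψ) = E(ω(p_{b'}) (ω(k̃)Ψ))`.
This is the interface between reduction theory (the rational element `r = r_F(γ)`, isometric: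
★ `AdelicMetaplecticRationalLiftIsometric`) and the domination of `{ω(k̃)Ψ}` over a compact set of
`k = π(k̃)` in the boundedness step of the Siegel–Weil formula ([Weil1965] n° 47 Lemma 20, n° 50):
whoever dominates `{ω(q_k)Ψ}` for ONE family of implementers `q_k` dominates `{ω(k̃)Ψ}` after the
rescaling `√(L(k̃)/L(q_k))`.

References: A. Weil, *Sur certains groupes d'opérateurs unitaires*, Acta Math. 111 (1964), Chap. I
n° 13, Chap. III n° 37 [Weil1964]; A. Weil, *Sur la formule de Siegel…*, Acta Math. 113 (1965), n° 47,
50 [Weil1965]; S. Gelbart, J. Rogawski, *L-functions and Fourier–Jacobi coefficients for the unitary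
group U(3)*, Invent. Math. 105 (1991), §3.1 [GelbartRogawski1991].
-/

noncomputable section

open _root_.MeasureTheory NumberField
open scoped ENNReal

namespace Literature.NumberTheory.Weil1964

open Literature.RepresentationTheory.HeisenbergGroup Literature.NumberTheory.Automorphic

variable (F : Type) [Field F] [NumberField F] {n : ℕ}
variable (T : Matrix (Fin n) (Fin n) (AdeleRing (𝓞 F) F)) (hT : IsUnit T.det)
variable [MeasurableSpace (AdeleRing (𝓞 F) F)] [BorelSpace (AdeleRing (𝓞 F) F)]
variable (ν : Measure (Fin n → AdeleRing (𝓞 F) F)) [ν.IsAddHaarMeasure]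

/-! ### Two lifts of one symplectic element differ by a central scalar -/

include hT in
omit [MeasurableSpace (AdeleRing (𝓞 F) F)] [BorelSpace (AdeleRing (𝓞 F) F)] in
/-- **`π(p) = π(p') ⇒ p' = p · (1, t·id)`** for some `t ∈ ℂˣ` (exactness of `1 → ℂˣ → Mp → Sp` at the middle).
[cite: GelbartRogawski1991, §3.1 p. 454; Weil1964, Chap. III n° 37 p. 188] -/
theorem adelicMpCont.exists_eq_mul_ofScalar_of_proj_eq (p p' : adelicMpCont F (Fin n) T)
    (h : adelicMpCont.proj F (Fin n) T p = adelicMpCont.proj F (Fin n) T p') :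
    ∃ t : ℂˣ, p' = p * adelicMpCont.ofScalar F (Fin n) T t := by
  have h1 : adelicMpCont.proj F (Fin n) T (p⁻¹ * p') = 1 :=
    (map_mul (adelicMpCont.proj F (Fin n) T) p⁻¹ p').trans <|
      (congrArg (· * adelicMpCont.proj F (Fin n) T p') (map_inv (adelicMpCont.proj F (Fin n) T) p)).trans <|
        (congrArg (fun z => z⁻¹ * adelicMpCont.proj F (Fin n) T p') h).trans <| inv_mul_cancel _
  exact (adelicMpCont.exists_eq_ofScalar_of_proj_eq_one ((Matrix.isUnit_iff_isUnit_det T).mpr hT) (p⁻¹ * p') h1).elim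
    fun t ht => ⟨t, (mul_inv_cancel_left p p').symm.trans (congrArg (HMul.hMul p) ht)⟩

/-- `L(p · (1, t·id)) = L(p) · ‖t‖²`. [cite: Weil1964, Chap. I n° 13 p. 160] -/
theorem adelicMpCont.l2Scaling_eq_mul_of_eq_mul_ofScalar {p p' : adelicMpCont F (Fin n) T} {t : ℂˣ}
    (ht : p' = p * adelicMpCont.ofScalar F (Fin n) T t) :
    adelicMpCont.l2Scaling F T hT ν p' = adelicMpCont.l2Scaling F T hT ν p * ‖(t : ℂ)‖ₑ ^ 2 := by
  rw [ht, adelicMpCont.l2Scaling_mul, l2Scaling_ofScalar]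

/-- `‖t‖ₑ² = L(p')/L(p)` when `p' = p · (1, t·id)`. [cite: Weil1964, Chap. I n° 13 p. 160] -/
theorem adelicMpCont.enorm_sq_eq_div_of_eq_mul_ofScalar {p p' : adelicMpCont F (Fin n) T} {t : ℂˣ}
    (ht : p' = p * adelicMpCont.ofScalar F (Fin n) T t) :
    ‖(t : ℂ)‖ₑ ^ 2 = adelicMpCont.l2Scaling F T hT ν p' / adelicMpCont.l2Scaling F T hT ν p := by
  rw [adelicMpCont.l2Scaling_eq_mul_of_eq_mul_ofScalar F T hT ν ht, mul_comm,
    ENNReal.mul_div_cancel_right (adelicMpCont.l2Scaling_ne_zero F T hT ν p) (adelicMpCont.l2Scaling_ne_top F T hT ν p)]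

/-- `‖t‖ = √(L(p')/L(p))` (real form) when `p' = p · (1, t·id)`. [cite: Weil1964, Chap. I n° 13 p. 160] -/
theorem adelicMpCont.norm_eq_sqrt_div_of_eq_mul_ofScalar {p p' : adelicMpCont F (Fin n) T} {t : ℂˣ}
    (ht : p' = p * adelicMpCont.ofScalar F (Fin n) T t) :
    ‖(t : ℂ)‖ = Real.sqrt ((adelicMpCont.l2Scaling F T hT ν p').toReal / (adelicMpCont.l2Scaling F T hT ν p).toReal) := by
  have h := adelicMpCont.enorm_sq_eq_div_of_eq_mul_ofScalar F T hT ν ht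
  have h2 : ‖(t : ℂ)‖ ^ 2 = (adelicMpCont.l2Scaling F T hT ν p').toReal / (adelicMpCont.l2Scaling F T hT ν p).toReal := by
    have h' := congrArg ENNReal.toReal h
    rw [ENNReal.toReal_pow, toReal_enorm, ENNReal.toReal_div] at h'
    exact h'
  rw [← h2, Real.sqrt_sq (norm_nonneg _)]

/-! ### The pointwise modulus of `ω(p)Φ` depends only on `(π(p), L(p))` -/

omit [MeasurableSpace (AdeleRing (𝓞 F) F)] [BorelSpace (AdeleRing (𝓞 F) F)] in
/-- `(ω(p · (1, t·id))Φ)(x) = t · (ω(p)Φ)(x)`. [cite: GelbartRogawski1991, §3.1 p. 454] -/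
theorem adelicMpCont.coe_omega_apply_of_eq_mul_ofScalar {p p' : adelicMpCont F (Fin n) T} {t : ℂˣ}
    (ht : p' = p * adelicMpCont.ofScalar F (Fin n) T t) (Φ : piSchwartzBruhat F (Fin n))
    (x : Fin n → AdeleRing (𝓞 F) F) :
    ((adelicMpCont.omega F (Fin n) T p' Φ : piSchwartzBruhat F (Fin n)) : (Fin n → AdeleRing (𝓞 F) F) → ℂ) x =
      (t : ℂ) * ((adelicMpCont.omega F (Fin n) T p Φ : piSchwartzBruhat F (Fin n)) : (Fin n → AdeleRing (𝓞 F) F) → ℂ) x := by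
  subst ht
  have e : adelicMpCont.omega F (Fin n) T (p * adelicMpCont.ofScalar F (Fin n) T t) Φ =
      (t : ℂ) • adelicMpCont.omega F (Fin n) T p Φ :=
    (adelicMpCont.omega_mul_apply F T p _ Φ).trans <|
      (congrArg (adelicMpCont.omega F (Fin n) T p) (adelicMpCont.omega_ofScalar (F := F) (T := T) t Φ)).trans (map_smul _ _ _)
  exact congrArg (fun Ψ : piSchwartzBruhat F (Fin n) => ((Ψ : piSchwartzBruhat F (Fin n)) : (Fin n → AdeleRing (𝓞 F) F) → ℂ) x) e

/-- **`‖(ω(p')Φ)(x)‖ = √(L(p')/L(p)) · ‖(ω(p)Φ)(x)‖` whenever `π(p) = π(p')`**: the pointwise modulus of the Weil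
operator of a lift depends only on the symplectic element and the `L²` modulus of the lift. [cite: Weil1964, Chap. I n° 13 p. 160; Weil1965, n° 47] -/
theorem adelicMpCont.norm_omega_apply_of_proj_eq (p p' : adelicMpCont F (Fin n) T)
    (h : adelicMpCont.proj F (Fin n) T p = adelicMpCont.proj F (Fin n) T p') (Φ : piSchwartzBruhat F (Fin n))
    (x : Fin n → AdeleRing (𝓞 F) F) :
    ‖((adelicMpCont.omega F (Fin n) T p' Φ : piSchwartzBruhat F (Fin n)) : (Fin n → AdeleRing (𝓞 F) F) → ℂ) x‖ =
      Real.sqrt ((adelicMpCont.l2Scaling F T hT ν p').toReal / (adelicMpCont.l2Scaling F T hT ν p).toReal) *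
        ‖((adelicMpCont.omega F (Fin n) T p Φ : piSchwartzBruhat F (Fin n)) : (Fin n → AdeleRing (𝓞 F) F) → ℂ) x‖ := by
  refine (adelicMpCont.exists_eq_mul_ofScalar_of_proj_eq F T hT p p' h).elim fun t ht => ?_
  exact (congrArg norm (adelicMpCont.coe_omega_apply_of_eq_mul_ofScalar F T ht Φ x)).trans <|
    (norm_mul _ _).trans (congrArg (· * _) (adelicMpCont.norm_eq_sqrt_div_of_eq_mul_ofScalar F T hT ν ht))

/-- **Equal projection and equal modulus ⇒ equal pointwise modulus**: `π(p) = π(p')`, `L(p) = L(p')` ⇒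
`‖(ω(p')Φ)(x)‖ = ‖(ω(p)Φ)(x)‖`. [cite: Weil1964, Chap. I n° 13 p. 160; Weil1965, n° 47] -/
theorem adelicMpCont.norm_omega_apply_eq_of_proj_eq_of_l2Scaling_eq (p p' : adelicMpCont F (Fin n) T)
    (h : adelicMpCont.proj F (Fin n) T p = adelicMpCont.proj F (Fin n) T p')
    (hL : adelicMpCont.l2Scaling F T hT ν p = adelicMpCont.l2Scaling F T hT ν p') (Φ : piSchwartzBruhat F (Fin n))
    (x : Fin n → AdeleRing (𝓞 F) F) :
    ‖((adelicMpCont.omega F (Fin n) T p' Φ : piSchwartzBruhat F (Fin n)) : (Fin n → AdeleRing (𝓞 F) F) → ℂ) x‖ =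
      ‖((adelicMpCont.omega F (Fin n) T p Φ : piSchwartzBruhat F (Fin n)) : (Fin n → AdeleRing (𝓞 F) F) → ℂ) x‖ := by
  have hq : Real.sqrt ((adelicMpCont.l2Scaling F T hT ν p').toReal / (adelicMpCont.l2Scaling F T hT ν p).toReal) = 1 := by
    rw [hL, div_self (ENNReal.toReal_ne_zero.mpr
      ⟨adelicMpCont.l2Scaling_ne_zero F T hT ν p', adelicMpCont.l2Scaling_ne_top F T hT ν p'⟩), Real.sqrt_one]
  exact (adelicMpCont.norm_omega_apply_of_proj_eq F T hT ν p p' h Φ x).trans <|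
    (congrArg (· * _) hq).trans (one_mul _)

/-! ### The lift `k̃ = p_{b'}⁻¹ · r · p_b` of a reduction identity -/

omit [MeasurableSpace (AdeleRing (𝓞 F) F)] [BorelSpace (AdeleRing (𝓞 F) F)] in
/-- Group bookkeeping: with `k̃ := q⁻¹ · r · p` one has `p = r⁻¹ · q · k̃`. [folklore] -/
private theorem eq_inv_mul_mul_lift (p q r : adelicMpCont F (Fin n) T) : p = r⁻¹ * q * (q⁻¹ * r * p) := by
  group

omit [MeasurableSpace (AdeleRing (𝓞 F) F)] [BorelSpace (AdeleRing (𝓞 F) F)] in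
/-- `π(q⁻¹ · r · p) = π(q)⁻¹ π(r) π(p)` — the lift `k̃` lies over the compact-part element `k = b'⁻¹ γ b` of the
reduction identity. [cite: Weil1965, n° 47 Lemma 20] -/
theorem adelicMpCont.proj_inv_mul_mul (p q r : adelicMpCont F (Fin n) T) :
    adelicMpCont.proj F (Fin n) T (q⁻¹ * r * p) =
      (adelicMpCont.proj F (Fin n) T q)⁻¹ * adelicMpCont.proj F (Fin n) T r * adelicMpCont.proj F (Fin n) T p :=
  (map_mul (adelicMpCont.proj F (Fin n) T) (q⁻¹ * r) p).trans <|
    congrArg (· * adelicMpCont.proj F (Fin n) T p) <|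
      (map_mul (adelicMpCont.proj F (Fin n) T) q⁻¹ r).trans <|
        congrArg (· * adelicMpCont.proj F (Fin n) T r) (map_inv (adelicMpCont.proj F (Fin n) T) q)

/-- `L(q⁻¹ · r · p) = L(q)⁻¹ · L(r) · L(p)`; in particular `= L(p)/L(q)` for an isometric `r` (e.g. `r = r_F(γ)`,
★ `l2Scaling_eq_one_of_mem_range_ratThetaLiftCont`). [cite: Weil1964, Chap. I n° 13 p. 160; Weil1965, n° 47] -/
theorem adelicMpCont.l2Scaling_inv_mul_mul (p q r : adelicMpCont F (Fin n) T) :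
    adelicMpCont.l2Scaling F T hT ν (q⁻¹ * r * p) =
      (adelicMpCont.l2Scaling F T hT ν q)⁻¹ * adelicMpCont.l2Scaling F T hT ν r * adelicMpCont.l2Scaling F T hT ν p :=
  (adelicMpCont.l2Scaling_mul F T hT ν (q⁻¹ * r) p).trans <|
    congrArg (· * adelicMpCont.l2Scaling F T hT ν p) <|
      (adelicMpCont.l2Scaling_mul F T hT ν q⁻¹ r).trans <|
        congrArg (· * adelicMpCont.l2Scaling F T hT ν r) (adelicMpCont.l2Scaling_inv F T hT ν q)

/-- The isometric case: `L(r) = 1 ⇒ L(q⁻¹ · r · p) = L(p) / L(q)`. [cite: Weil1964, Chap. I n° 13 p. 160; Weil1965, n° 47] -/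
theorem adelicMpCont.l2Scaling_inv_mul_mul_of_l2Scaling_eq_one (p q r : adelicMpCont F (Fin n) T)
    (hr : adelicMpCont.l2Scaling F T hT ν r = 1) :
    adelicMpCont.l2Scaling F T hT ν (q⁻¹ * r * p) =
      adelicMpCont.l2Scaling F T hT ν p / adelicMpCont.l2Scaling F T hT ν q := by
  refine (adelicMpCont.l2Scaling_inv_mul_mul F T hT ν p q r).trans ?_
  refine (congrArg (fun z => (adelicMpCont.l2Scaling F T hT ν q)⁻¹ * z * adelicMpCont.l2Scaling F T hT ν p) hr).trans ?_
  refine (congrArg (· * adelicMpCont.l2Scaling F T hT ν p) (mul_one _)).trans ?_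
  exact (mul_comm _ _).trans (div_eq_mul_inv _ _).symm

omit [MeasurableSpace (AdeleRing (𝓞 F) F)] [BorelSpace (AdeleRing (𝓞 F) F)] in
/-- **Transport of an `r⁻¹`-invariant functional along the reduction identity**: if `E ∘ ω(r⁻¹) = E` then
`E(ω(p)Ψ) = E(ω(q)(ω(q⁻¹ r p)Ψ))` — the value at the (wide-ray) point `p` is the value at the (good-ray) point
`q` on the TRANSLATED test function `ω(k̃)Ψ`. [cite: Weil1965, n° 47 Lemma 20 and n° 50] -/
theorem adelicMpCont.apply_omega_eq_of_comp_omega_inv_eq (E : piSchwartzBruhat F (Fin n) →ₗ[ℂ] ℂ)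
    (p q r : adelicMpCont F (Fin n) T) (hE : E ∘ₗ adelicMpCont.omega F (Fin n) T r⁻¹ = E)
    (Ψ : piSchwartzBruhat F (Fin n)) :
    E (adelicMpCont.omega F (Fin n) T p Ψ) =
      E (adelicMpCont.omega F (Fin n) T q (adelicMpCont.omega F (Fin n) T (q⁻¹ * r * p) Ψ)) := by
  calc E (adelicMpCont.omega F (Fin n) T p Ψ)
      = E (adelicMpCont.omega F (Fin n) T (r⁻¹ * q * (q⁻¹ * r * p)) Ψ) :=
        congrArg (fun z => E (adelicMpCont.omega F (Fin n) T z Ψ)) (eq_inv_mul_mul_lift F T p q r)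
    _ = E (adelicMpCont.omega F (Fin n) T r⁻¹
          (adelicMpCont.omega F (Fin n) T q (adelicMpCont.omega F (Fin n) T (q⁻¹ * r * p) Ψ))) :=
        congrArg E ((adelicMpCont.omega_mul_apply F T (r⁻¹ * q) (q⁻¹ * r * p) Ψ).trans
          (adelicMpCont.omega_mul_apply F T r⁻¹ q _))
    _ = (E ∘ₗ adelicMpCont.omega F (Fin n) T r⁻¹)
          (adelicMpCont.omega F (Fin n) T q (adelicMpCont.omega F (Fin n) T (q⁻¹ * r * p) Ψ)) := rfl
    _ = E (adelicMpCont.omega F (Fin n) T q (adelicMpCont.omega F (Fin n) T (q⁻¹ * r * p) Ψ)) :=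
        LinearMap.congr_fun hE _

end Literature.NumberTheory.Weil1964
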